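import Mathlib
import Literature.Analysis.ValidatedNumerics.TaylorModelIntegralCertTrig
import Literature.Analysis.ValidatedNumerics.TaylorModelExpr
import Literature.MathematicalPhysics.MHD.CerfonFreidbergSolutions
import Summits.Ventures.FusionMHD.Models.CerfonFreidbergIterLikeQHalfShearDefs
import Summits.Ventures.FusionMHD.Models.CerfonFreidbergIterLikeQHalfRay
import HarnessLib

/-!
# Ventures/FusionMHD — Models/CerfonFreidbergIterLikeQHalfShearSound.lean: SOUNDNESS of the shear-register obligation at `ψ_N = 1/2` of THE
# Cerfon–Freidberg ITER-like instance — what `CFIterLike.QHalfShear.ShearCert.ok = true` MEANS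

HONEST FRAMING (LADDER-GRIDFUSION three columns; CF rung; successor step (3) of «q′(ψ_N = 1/2) on the CF rung», F2-SCOPING v1.6 §10(c)).
The 254-statement block `CFIterLike.QHalfShear.blockQ` is executed symbolically in THREE pieces (a single `simp` over the whole block overflows
the farm node: `node-rc=250`): `block1` (123 statements: `θ, cos, sin, X, Y, log X, X², Y², U_X, U_Y ⇒ D = D_r`), `block2` (120: `U_XX, U_XY, U_YY ⇒
F2 = ∂_s D_r`), `block3` (11: numerator `X_a·D − m·X·F2`, denominator `(X·D)²·D`, `inv`, `K`, `K·p`), with `blockQ = block1 ++ block2 ++ block3` by `rfl`.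
* §1 `block1_regs` / `block2_regs` / `block3_regs` — register semantics of each piece for ANY incoming stack described by hypotheses (closed forms
  `CFIterLike.QHalf.Drc`, `F2c` of the tree);
* §2 at THE instance (`CFIterLike.QHalf.params`, `mA` = ★ #117's approximant): **`progQ_toFunP`** — the program's function IS the shear kernel
  `(X_a·D − m·R·F2)/((R·D)²·D)·π` along `mA` with `D = Drc coeff X_a (mA t) (πt)` (= model-7's `Dfield`), `F2 = F2c coeff X_a (mA t) (πt)` (= `F2field`),
  `R = X_a + mA t cos(πt)` — i.e. `polarKernelDs X_a Dfield F2field θ s / Dfield θ s · π` at `θ = πt`, `s = mA t`;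
* §3 **`sound_of_ok`**: `ShearCert.ok d = true` ⇒ `FSegOK (progQ.toFunP params) [1] 2⁶⁰ (2jh) (2(j+1)h) plo phi`.
NOT here (successor steps (4)–(5)): the tube link to the TRUE surface (`LevelPanel.kernel_integral_tube` + third-ray-derivative box bound) and the
assembly with `hasDerivAt_safetyFactorE_half`.  MODELLED: analytic Cerfon–Freidberg family; nothing about a device or stability.
Typer/prover: gridfusion-model-5 (g8), 2026-08-27.  Citations: Freidberg 2014 §6.3.5 (6.35) [Freidberg2014]; Melquiond 2008 §3.3 [Melquiond2008];
Mahboubi–Melquiond–Sibut-Pinote 2016 §3.2 Lemma 3, §4.1 [MahboubiMelquiondSibutpinote2016].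
-/

noncomputable section

open Set
open Literature.Analysis.ValidatedNumerics Literature.Analysis.ValidatedNumerics.PolyMP
open Literature.Analysis.ValidatedNumerics.NumericsMP Literature.Analysis.ValidatedNumerics.ExpPoly
open Literature.Analysis.ODE
open Literature.MathematicalPhysics.MHD Literature.MathematicalPhysics.MHD.CerfonFreidberg

set_option autoImplicit false

namespace Summit.Ventures.FusionMHD.Models.CFIterLike.QHalfShear

set_option maxRecDepth 100000

/-! ## §1 The three pieces of `blockQ` and their symbolic execution -/

/-- Piece 1 of `blockQ` (123 statements): `θ, cos θ, sin θ, X, Y, log X, X², Y², U_X, U_Y ⇒ D`. -/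
def block1 : TProg :=
  [TOp.base (SOp.poly [0, 1]), TOp.base (SOp.mul 306 0), TOp.cos 0, TOp.sin 1, TOp.base (SOp.mul 4 1),
   TOp.base (SOp.add 308 0), TOp.base (SOp.mul 6 2), TOp.base (SOp.log 1), TOp.base (SOp.mul 2 2),
   TOp.base (SOp.mul 2 2), TOp.base (SOp.poly [2]), TOp.base (SOp.mul 0 308), TOp.base (SOp.neg 310),
   TOp.base (SOp.add 1 0), TOp.base (SOp.poly [(-8)]), TOp.base (SOp.mul 0 314), TOp.base (SOp.poly [(-30)]),
   TOp.base (SOp.mul 0 317), TOp.base (SOp.add 2 0), TOp.base (SOp.poly [16]), TOp.base (SOp.mul 0 321),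
   TOp.base (SOp.poly [(-400)]), TOp.base (SOp.mul 0 324), TOp.base (SOp.add 2 0), TOp.base (SOp.mul 0 14),
   TOp.base (SOp.add 6 0), TOp.base (SOp.mul 0 16), TOp.base (SOp.add 13 0), TOp.base (SOp.poly [(1 / 2)]),
   TOp.base (SOp.poly [4]), TOp.base (SOp.mul 0 329), TOp.base (SOp.add 2 0), TOp.base (SOp.poly [3]),
   TOp.base (SOp.mul 0 333), TOp.base (SOp.add 2 0), TOp.base (SOp.poly [(-48)]), TOp.base (SOp.mul 0 337),
   TOp.base (SOp.poly [480]), TOp.base (SOp.mul 0 340), TOp.base (SOp.add 2 0), TOp.base (SOp.mul 0 30),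
   TOp.base (SOp.add 6 0), TOp.base (SOp.poly [6]), TOp.base (SOp.mul 0 344), TOp.base (SOp.poly [(-15)]),
   TOp.base (SOp.mul 0 347), TOp.base (SOp.add 2 0), TOp.base (SOp.mul 0 38), TOp.base (SOp.add 6 0),
   TOp.base (SOp.mul 0 40), TOp.base (SOp.add 22 0), TOp.base (SOp.mul 45 0), TOp.base (SOp.poly [(-2)]),
   TOp.base (SOp.mul 0 351), TOp.base (SOp.poly [(-24)]), TOp.base (SOp.mul 0 355), TOp.base (SOp.poly [(-240)]),
   TOp.base (SOp.mul 0 359), TOp.base (SOp.mul 0 48), TOp.base (SOp.add 3 0), TOp.base (SOp.mul 0 50),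
   TOp.base (SOp.add 7 0), TOp.base (SOp.poly [12]), TOp.base (SOp.mul 0 363), TOp.base (SOp.poly [720]),
   TOp.base (SOp.mul 0 367), TOp.base (SOp.mul 0 56), TOp.base (SOp.add 3 0), TOp.base (SOp.poly [(-90)]),
   TOp.base (SOp.mul 0 371), TOp.base (SOp.mul 0 61), TOp.base (SOp.add 3 0), TOp.base (SOp.mul 0 63),
   TOp.base (SOp.add 11 0), TOp.base (SOp.mul 68 0), TOp.base (SOp.mul 67 0), TOp.base (SOp.add 24 0),
   TOp.base (SOp.mul 66 375), TOp.base (SOp.poly [8]), TOp.base (SOp.mul 0 379), TOp.base (SOp.poly [48]),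
   TOp.base (SOp.mul 0 383), TOp.base (SOp.mul 0 72), TOp.base (SOp.add 3 0), TOp.base (SOp.mul 0 74),
   TOp.base (SOp.add 7 0), TOp.base (SOp.mul 79 0), TOp.base (SOp.poly [(-18)]), TOp.base (SOp.mul 0 388),
   TOp.base (SOp.add 73 0), TOp.base (SOp.poly [32]), TOp.base (SOp.mul 0 392), TOp.base (SOp.poly [(-560)]),
   TOp.base (SOp.mul 0 395), TOp.base (SOp.add 2 0), TOp.base (SOp.mul 0 85), TOp.base (SOp.add 6 0),
   TOp.base (SOp.mul 90 0), TOp.base (SOp.mul 43 399), TOp.base (SOp.poly [150]), TOp.base (SOp.mul 0 402),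
   TOp.base (SOp.add 2 0), TOp.base (SOp.mul 95 0), TOp.base (SOp.mul 0 94), TOp.base (SOp.add 6 0),
   TOp.base (SOp.mul 0 96), TOp.base (SOp.add 19 0), TOp.base (SOp.poly [(-480)]), TOp.base (SOp.mul 0 410),
   TOp.base (SOp.mul 0 99), TOp.base (SOp.add 54 0), TOp.base (SOp.mul 104 0), TOp.base (SOp.poly [360]),
   TOp.base (SOp.mul 0 415), TOp.base (SOp.mul 107 0), TOp.base (SOp.mul 0 106), TOp.base (SOp.add 4 0),
   TOp.base (SOp.mul 0 108), TOp.base (SOp.mul 110 0), TOp.base (SOp.add 12 0), TOp.base (SOp.mul 43 117),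
   TOp.base (SOp.mul 1 117), TOp.base (SOp.add 1 0)]

/-- Piece 2 of `blockQ` (120 statements): `U_XX, U_XY, U_YY ⇒ F2`. -/
def block2 : TProg :=
  [TOp.base (SOp.poly [(-3)]), TOp.base (SOp.mul 0 422), TOp.base (SOp.add 113 0), TOp.base (SOp.poly [(-54)]),
   TOp.base (SOp.mul 0 427), TOp.base (SOp.add 112 0), TOp.base (SOp.poly [(-640)]), TOp.base (SOp.mul 0 432),
   TOp.base (SOp.add 110 0), TOp.base (SOp.mul 0 122), TOp.base (SOp.add 4 0), TOp.base (SOp.mul 0 124),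
   TOp.base (SOp.add 9 0), TOp.base (SOp.poly [(3 / 2)]), TOp.base (SOp.mul 74 436), TOp.base (SOp.add 1 0),
   TOp.base (SOp.poly [21]), TOp.base (SOp.mul 0 440), TOp.base (SOp.add 2 0), TOp.base (SOp.poly [(-144)]),
   TOp.base (SOp.mul 0 444), TOp.base (SOp.poly [2160]), TOp.base (SOp.mul 0 447), TOp.base (SOp.add 2 0),
   TOp.base (SOp.mul 0 137), TOp.base (SOp.add 6 0), TOp.base (SOp.poly [30]), TOp.base (SOp.mul 0 451),
   TOp.base (SOp.poly [(-165)]), TOp.base (SOp.mul 0 454), TOp.base (SOp.add 2 0), TOp.base (SOp.mul 0 145),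
   TOp.base (SOp.add 6 0), TOp.base (SOp.mul 0 147), TOp.base (SOp.add 21 0), TOp.base (SOp.poly [36]),
   TOp.base (SOp.mul 0 459), TOp.base (SOp.mul 14 150), TOp.base (SOp.add 1 0), TOp.base (SOp.poly [(-450)]),
   TOp.base (SOp.mul 0 465), TOp.base (SOp.mul 0 155), TOp.base (SOp.add 3 0), TOp.base (SOp.mul 0 157),
   TOp.base (SOp.add 105 0), TOp.base (SOp.mul 160 0), TOp.base (SOp.add 11 0), TOp.base (SOp.poly [(-16)]),
   TOp.base (SOp.mul 0 470), TOp.base (SOp.poly [(-60)]), TOp.base (SOp.mul 0 473), TOp.base (SOp.add 2 0),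
   TOp.base (SOp.poly [64]), TOp.base (SOp.mul 0 477), TOp.base (SOp.poly [(-1600)]), TOp.base (SOp.mul 0 480),
   TOp.base (SOp.add 2 0), TOp.base (SOp.mul 0 170), TOp.base (SOp.add 6 0), TOp.base (SOp.mul 175 0),
   TOp.base (SOp.poly [(-96)]), TOp.base (SOp.mul 0 485), TOp.base (SOp.poly [960]), TOp.base (SOp.mul 0 488),
   TOp.base (SOp.add 2 0), TOp.base (SOp.mul 181 0), TOp.base (SOp.mul 0 180), TOp.base (SOp.add 7 0),
   TOp.base (SOp.mul 185 0), TOp.base (SOp.mul 156 492), TOp.base (SOp.poly [(-960)]), TOp.base (SOp.mul 0 496),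
   TOp.base (SOp.mul 0 185), TOp.base (SOp.add 3 0), TOp.base (SOp.mul 190 0), TOp.base (SOp.poly [1440]),
   TOp.base (SOp.mul 0 501), TOp.base (SOp.mul 193 0), TOp.base (SOp.mul 0 192), TOp.base (SOp.add 4 0),
   TOp.base (SOp.mul 197 0), TOp.base (SOp.mul 196 0), TOp.base (SOp.add 13 0), TOp.base (SOp.poly [24]),
   TOp.base (SOp.mul 0 507), TOp.base (SOp.poly [240]), TOp.base (SOp.mul 0 511), TOp.base (SOp.mul 0 200),
   TOp.base (SOp.add 3 0), TOp.base (SOp.mul 0 202), TOp.base (SOp.add 135 0), TOp.base (SOp.poly [96]),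
   TOp.base (SOp.mul 0 516), TOp.base (SOp.poly [(-1680)]), TOp.base (SOp.mul 0 519), TOp.base (SOp.add 2 0),
   TOp.base (SOp.mul 0 209), TOp.base (SOp.add 130 0), TOp.base (SOp.mul 119 212), TOp.base (SOp.add 1 0),
   TOp.base (SOp.mul 0 214), TOp.base (SOp.add 10 0), TOp.base (SOp.poly [(-1440)]), TOp.base (SOp.mul 0 528),
   TOp.base (SOp.mul 0 217), TOp.base (SOp.add 172 0), TOp.base (SOp.mul 115 220), TOp.base (SOp.add 1 0),
   TOp.base (SOp.mul 0 222), TOp.base (SOp.mul 224 0), TOp.base (SOp.add 8 0), TOp.base (SOp.mul 231 231),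
   TOp.base (SOp.mul 231 231), TOp.base (SOp.mul 233 232), TOp.base (SOp.mul 2 67), TOp.base (SOp.mul 1 32),
   TOp.base (SOp.mul 228 0), TOp.base (SOp.add 2 0), TOp.base (SOp.mul 5 7), TOp.base (SOp.add 1 0)]

/-- Piece 3 of `blockQ` (11 statements): numerator, denominator, `inv`, `K`, `K·p`. -/
def block3 : TProg :=
  [TOp.base (SOp.mul 546 120), TOp.base (SOp.mul 244 238), TOp.base (SOp.mul 0 2), TOp.base (SOp.neg 0),
   TOp.base (SOp.add 3 0), TOp.base (SOp.mul 242 125), TOp.base (SOp.mul 0 0), TOp.base (SOp.mul 0 127),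
   TOp.base (SOp.inv 0), TOp.base (SOp.mul 4 0), TOp.base (SOp.mul 0 558)]

/-- `blockQ` is the concatenation of its three pieces. -/
theorem blockQ_split : CFIterLike.QHalfShear.blockQ = block1 ++ block2 ++ block3 := rfl

/-- Lengths of the pieces. -/
theorem block_lengths : CFIterLike.QHalfShear.block1.length = 123 ∧ block2.length = 120 ∧ block3.length = 11 := by decide

set_option maxHeartbeats 4000000 in
/-- **Piece 1**: for any stack with top `f₀` and the constants at depths `296…305`, after `block1` the top register is `Drc c X_a (f₀ t) (p t)` and the
registers at depths 117, 116, 115, 114, 113, 120, 119, 123 are `X, Y, log X, X·X, Y·Y, cos, sin, f₀`. -/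
theorem block1_regs (stk : List (ℝ → ℝ)) (c : Fin 7 → ℝ) (Xa Ua p : ℝ) (f0 : ℝ → ℝ)
    (h0 : getReg (fun _ => (0 : ℝ)) stk 0 = f0)
    (_hc0 : getReg (fun _ => (0 : ℝ)) stk 296 = fun _ => c 0)
    (hc1 : getReg (fun _ => (0 : ℝ)) stk 297 = fun _ => c 1)
    (hc2 : getReg (fun _ => (0 : ℝ)) stk 298 = fun _ => c 2)
    (hc3 : getReg (fun _ => (0 : ℝ)) stk 299 = fun _ => c 3)
    (hc4 : getReg (fun _ => (0 : ℝ)) stk 300 = fun _ => c 4)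
    (hc5 : getReg (fun _ => (0 : ℝ)) stk 301 = fun _ => c 5)
    (hc6 : getReg (fun _ => (0 : ℝ)) stk 302 = fun _ => c 6)
    (hXa : getReg (fun _ => (0 : ℝ)) stk 303 = fun _ => Xa)
    (_hUa : getReg (fun _ => (0 : ℝ)) stk 304 = fun _ => Ua)
    (hp : getReg (fun _ => (0 : ℝ)) stk 305 = fun _ => p) :
    getReg (fun _ => (0 : ℝ)) (TProg.runF CFIterLike.QHalfShear.block1 stk) 0 = (fun t => CFIterLike.QHalf.Drc c Xa (f0 t) (p * t))
    ∧ getReg (fun _ => (0 : ℝ)) (TProg.runF block1 stk) 117 = (fun t => Xa + f0 t * Real.cos (p * t))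
    ∧ getReg (fun _ => (0 : ℝ)) (TProg.runF block1 stk) 116 = (fun t => f0 t * Real.sin (p * t))
    ∧ getReg (fun _ => (0 : ℝ)) (TProg.runF block1 stk) 115 = (fun t => Real.log (Xa + f0 t * Real.cos (p * t)))
    ∧ getReg (fun _ => (0 : ℝ)) (TProg.runF block1 stk) 114 = (fun t => (Xa + f0 t * Real.cos (p * t)) * (Xa + f0 t * Real.cos (p * t)))
    ∧ getReg (fun _ => (0 : ℝ)) (TProg.runF block1 stk) 113 = (fun t => (f0 t * Real.sin (p * t)) * (f0 t * Real.sin (p * t)))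
    ∧ getReg (fun _ => (0 : ℝ)) (TProg.runF block1 stk) 120 = (fun t => Real.cos (p * t))
    ∧ getReg (fun _ => (0 : ℝ)) (TProg.runF block1 stk) 119 = (fun t => Real.sin (p * t))
    ∧ getReg (fun _ => (0 : ℝ)) (TProg.runF block1 stk) 123 = f0
    ∧ getReg (fun _ => (0 : ℝ)) (TProg.runF block1 stk) 112 = (fun _ => (2 : ℝ))
    ∧ getReg (fun _ => (0 : ℝ)) (TProg.runF block1 stk) 111 = (fun _ => ((2 : ℝ) * c 1))
    ∧ getReg (fun _ => (0 : ℝ)) (TProg.runF block1 stk) 107 = (fun _ => (((-8) : ℝ) * c 3))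
    ∧ getReg (fun _ => (0 : ℝ)) (TProg.runF block1 stk) 102 = (fun _ => ((16 : ℝ) * c 5))
    ∧ getReg (fun _ => (0 : ℝ)) (TProg.runF block1 stk) 87 = (fun _ => ((-48) : ℝ))
    ∧ getReg (fun _ => (0 : ℝ)) (TProg.runF block1 stk) 67 = (fun _ => (((-24) : ℝ) * c 4))
    ∧ getReg (fun _ => (0 : ℝ)) (TProg.runF block1 stk) 61 = (fun t => ((((-2) : ℝ) * c 2) + (((((-24) : ℝ) * c 4) + ((((-240) : ℝ) * c 6) * ((f0 t * Real.sin ((p * t))) * (f0 t * Real.sin ((p * t)))))) * ((f0 t * Real.sin ((p * t))) * (f0 t * Real.sin ((p * t)))))))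
    ∧ getReg (fun _ => (0 : ℝ)) (TProg.runF block1 stk) 60 = (fun _ => (12 : ℝ))
    ∧ getReg (fun _ => (0 : ℝ)) (TProg.runF block1 stk) 45 = (fun _ => ((2 : ℝ) * c 2))
    ∧ getReg (fun _ => (0 : ℝ)) (TProg.runF block1 stk) 33 = (fun _ => ((((-8) : ℝ) * c 3) + (((-18) : ℝ) * c 4)))
    ∧ getReg (fun _ => (0 : ℝ)) (TProg.runF block1 stk) 21 = (fun _ => ((((-24) : ℝ) * c 5) + ((150 : ℝ) * c 6)))
    ∧ getReg (fun _ => (0 : ℝ)) (TProg.runF block1 stk) 9 = (fun _ => ((360 : ℝ) * c 6)) := by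
  simp only [block1, TProg.runF, TOp.evalF, SOp.evalF, getReg_cons_zero, getReg_cons_succ, h0, hc1, hc2, hc3, hc4, hc5,
    hc6, hXa, hp, Poly.eval_cons, Poly.eval_nil, Rat.cast_zero, Rat.cast_one, zero_add, add_zero, mul_one, mul_zero]
  refine ⟨?_, ?_, ?_, ?_, ?_, ?_, ?_, ?_, ?_, ?_, ?_, ?_, ?_, ?_, ?_, ?_, ?_, ?_, ?_, ?_, ?_⟩
  · funext t; simp only [CFIterLike.QHalf.Drc, CFIterLike.QHalf.UXc, CFIterLike.QHalf.UYc]; push_cast; ring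
  all_goals first | trivial | rfl | (funext t; push_cast; ring)

set_option maxHeartbeats 4000000 in
/-- **Piece 2**: for any stack carrying `X, Y, log X, X·X, Y·Y, cos, sin` at depths 117, 116, 115, 114, 113, 120, 119
and the constants at depths `419…428`, after `block2` the top register is `F2c c X_a (f₀ t) (p t)`. -/
theorem block2_regs (stk : List (ℝ → ℝ)) (c : Fin 7 → ℝ) (Xa Ua p : ℝ) (f0 : ℝ → ℝ)
    (hX : getReg (fun _ => (0 : ℝ)) stk 117 = (fun t => Xa + f0 t * Real.cos (p * t)))
    (hY : getReg (fun _ => (0 : ℝ)) stk 116 = (fun t => f0 t * Real.sin (p * t)))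
    (hL : getReg (fun _ => (0 : ℝ)) stk 115 = (fun t => Real.log (Xa + f0 t * Real.cos (p * t))))
    (hXX : getReg (fun _ => (0 : ℝ)) stk 114 = (fun t => (Xa + f0 t * Real.cos (p * t)) * (Xa + f0 t * Real.cos (p * t))))
    (hYY : getReg (fun _ => (0 : ℝ)) stk 113 = (fun t => (f0 t * Real.sin (p * t)) * (f0 t * Real.sin (p * t))))
    (hct : getReg (fun _ => (0 : ℝ)) stk 120 = (fun t => Real.cos (p * t)))
    (hst : getReg (fun _ => (0 : ℝ)) stk 119 = (fun t => Real.sin (p * t)))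
    (e306 : getReg (fun _ => (0 : ℝ)) stk 112 = (fun _ => (2 : ℝ)))
    (e307 : getReg (fun _ => (0 : ℝ)) stk 111 = (fun _ => ((2 : ℝ) * c 1)))
    (e311 : getReg (fun _ => (0 : ℝ)) stk 107 = (fun _ => (((-8) : ℝ) * c 3)))
    (e316 : getReg (fun _ => (0 : ℝ)) stk 102 = (fun _ => ((16 : ℝ) * c 5)))
    (e331 : getReg (fun _ => (0 : ℝ)) stk 87 = (fun _ => ((-48) : ℝ)))
    (e351 : getReg (fun _ => (0 : ℝ)) stk 67 = (fun _ => (((-24) : ℝ) * c 4)))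
    (e357 : getReg (fun _ => (0 : ℝ)) stk 61 = (fun t => ((((-2) : ℝ) * c 2) + (((((-24) : ℝ) * c 4) + ((((-240) : ℝ) * c 6) * ((f0 t * Real.sin ((p * t))) * (f0 t * Real.sin ((p * t)))))) * ((f0 t * Real.sin ((p * t))) * (f0 t * Real.sin ((p * t))))))))
    (e358 : getReg (fun _ => (0 : ℝ)) stk 60 = (fun _ => (12 : ℝ)))
    (e373 : getReg (fun _ => (0 : ℝ)) stk 45 = (fun _ => ((2 : ℝ) * c 2)))
    (e385 : getReg (fun _ => (0 : ℝ)) stk 33 = (fun _ => ((((-8) : ℝ) * c 3) + (((-18) : ℝ) * c 4))))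
    (e397 : getReg (fun _ => (0 : ℝ)) stk 21 = (fun _ => ((((-24) : ℝ) * c 5) + ((150 : ℝ) * c 6))))
    (e409 : getReg (fun _ => (0 : ℝ)) stk 9 = (fun _ => ((360 : ℝ) * c 6)))
    (_hc0 : getReg (fun _ => (0 : ℝ)) stk 419 = fun _ => c 0)
    (_hc1 : getReg (fun _ => (0 : ℝ)) stk 420 = fun _ => c 1)
    (hc2 : getReg (fun _ => (0 : ℝ)) stk 421 = fun _ => c 2)
    (hc3 : getReg (fun _ => (0 : ℝ)) stk 422 = fun _ => c 3)
    (hc4 : getReg (fun _ => (0 : ℝ)) stk 423 = fun _ => c 4)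
    (hc5 : getReg (fun _ => (0 : ℝ)) stk 424 = fun _ => c 5)
    (hc6 : getReg (fun _ => (0 : ℝ)) stk 425 = fun _ => c 6)
    (_hXa : getReg (fun _ => (0 : ℝ)) stk 426 = fun _ => Xa)
    (_hUa : getReg (fun _ => (0 : ℝ)) stk 427 = fun _ => Ua)
    (_hp : getReg (fun _ => (0 : ℝ)) stk 428 = fun _ => p) :
    getReg (fun _ => (0 : ℝ)) (TProg.runF CFIterLike.QHalfShear.block2 stk) 0 = (fun t => CFIterLike.QHalf.F2c c Xa (f0 t) (p * t)) := by
  simp only [block2, TProg.runF, TOp.evalF, SOp.evalF, getReg_cons_zero, getReg_cons_succ, hX, hY, hL, hXX, hYY, hct, hst, e306, e307, e311, e316, e331, e351, e357, e358, e373, e385, e397, e409, hc2, hc3, hc4, hc5,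
    hc6, Poly.eval_cons, Poly.eval_nil, add_zero, mul_zero]
  funext t; simp only [CFIterLike.QHalf.F2c, CFIterLike.QHalf.UXXc, CFIterLike.QHalf.UXYc, CFIterLike.QHalf.UYYc]; push_cast; ring

/-- **Piece 3**: for any stack carrying `F2` on top, `D` at depth 120, `X` at depth 237, `f₀` at depth 243 and `X_a, p` at depths 546, 548, after
`block3` the top register is `(X_a·D − f₀·X·F2)·((X·D)²·D)⁻¹·p`. -/
theorem block3_regs (stk : List (ℝ → ℝ)) (Xa p : ℝ) (f0 FD FX FF2 : ℝ → ℝ)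
    (hF2 : getReg (fun _ => (0 : ℝ)) stk 0 = FF2)
    (hD : getReg (fun _ => (0 : ℝ)) stk 120 = FD)
    (hX : getReg (fun _ => (0 : ℝ)) stk 237 = FX)
    (hm : getReg (fun _ => (0 : ℝ)) stk 243 = f0)
    (hXa : getReg (fun _ => (0 : ℝ)) stk 546 = fun _ => Xa)
    (hp : getReg (fun _ => (0 : ℝ)) stk 548 = fun _ => p) (t : ℝ) :
    getReg (fun _ => (0 : ℝ)) (TProg.runF CFIterLike.QHalfShear.block3 stk) 0 t
      = (Xa * FD t - f0 t * FX t * FF2 t) * ((FX t * FD t) ^ 2 * FD t)⁻¹ * p := by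
  simp only [block3, TProg.runF, TOp.evalF, SOp.evalF, getReg_cons_zero, getReg_cons_succ, hF2, hD, hX, hm, hXa, hp]
  ring

/-! ## §2 The program's function at THE instance -/

/-- **The function certified by the integral segment IS the shear kernel along ★ #117's approximant, times `π`.** -/
theorem progQ_toFunP (t : ℝ) :
    CFIterLike.QHalfShear.progQ.toFunP CFIterLike.QHalf.params t
      = (Xa * CFIterLike.QHalf.Drc coeff Xa (CFIterLike.QHalf.mA t) (Real.pi * t)
            - CFIterLike.QHalf.mA t * (Xa + CFIterLike.QHalf.mA t * Real.cos (Real.pi * t)) * CFIterLike.QHalf.F2c coeff Xa (CFIterLike.QHalf.mA t) (Real.pi * t))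
          * (((Xa + CFIterLike.QHalf.mA t * Real.cos (Real.pi * t)) * CFIterLike.QHalf.Drc coeff Xa (CFIterLike.QHalf.mA t) (Real.pi * t)) ^ 2
              * CFIterLike.QHalf.Drc coeff Xa (CFIterLike.QHalf.mA t) (Real.pi * t))⁻¹ * Real.pi := by
  have hrun : TProg.runF progQ (constStack CFIterLike.QHalf.params)
      = TProg.runF block3 (TProg.runF block2 (TProg.runF block1 CFIterLike.QHalf.stkA)) := by
    rw [progQ, blockQ_split, CFIterLike.QHalf.runF_append, CFIterLike.QHalf.runF_append, CFIterLike.QHalf.runF_append]; rfl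
  have hP : ∀ i, getReg (fun _ => (0 : ℝ)) CFIterLike.QHalf.stkA (296 + i) = getReg (fun _ => (0 : ℝ)) (constStack CFIterLike.QHalf.params) i := CFIterLike.QHalf.stkA_param
  have h1 := block1_regs CFIterLike.QHalf.stkA coeff Xa (U Xa 0) Real.pi CFIterLike.QHalf.mA CFIterLike.QHalf.stkA_top
    (by rw [hP 0]; simp [constStack, CFIterLike.QHalf.params]) (by rw [hP 1]; simp [constStack, CFIterLike.QHalf.params]) (by rw [hP 2]; simp [constStack, CFIterLike.QHalf.params])
    (by rw [hP 3]; simp [constStack, CFIterLike.QHalf.params]) (by rw [hP 4]; simp [constStack, CFIterLike.QHalf.params]) (by rw [hP 5]; simp [constStack, CFIterLike.QHalf.params])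
    (by rw [hP 6]; simp [constStack, CFIterLike.QHalf.params]) (by rw [hP 7]; simp [constStack, CFIterLike.QHalf.params]) (by rw [hP 8]; simp [constStack, CFIterLike.QHalf.params])
    (by rw [hP 9]; simp [constStack, CFIterLike.QHalf.params])
  obtain ⟨hD, hX, hY, hL, hXX, hYY, hct, hst, hm, e306, e307, e311, e316, e331, e351, e357, e358, e373, e385, e397, e409⟩ := h1
  set stk1 := TProg.runF block1 CFIterLike.QHalf.stkA with hstk1
  have hP1 : ∀ i, getReg (fun _ => (0 : ℝ)) stk1 (123 + i) = getReg (fun _ => (0 : ℝ)) CFIterLike.QHalf.stkA i := by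
    intro i; rw [hstk1, ← block_lengths.1]; exact CFIterLike.QHalf.getReg_runF_add _ block1 _ i
  have q : ∀ j : ℕ, getReg (fun _ => (0 : ℝ)) stk1 (123 + (296 + j)) = getReg (fun _ => (0 : ℝ)) (constStack CFIterLike.QHalf.params) j :=
    fun j => (hP1 (296 + j)).trans (hP j)
  have h2 := block2_regs stk1 coeff Xa (U Xa 0) Real.pi CFIterLike.QHalf.mA hX hY hL hXX hYY hct hst e306 e307 e311 e316 e331 e351 e357 e358 e373 e385 e397 e409
    (by rw [show (419 : ℕ) = 123 + (296 + 0) by norm_num, q 0]; simp [constStack, CFIterLike.QHalf.params]) (by rw [show (420 : ℕ) = 123 + (296 + 1) by norm_num, q 1]; simp [constStack, CFIterLike.QHalf.params]) (by rw [show (421 : ℕ) = 123 + (296 + 2) by norm_num, q 2]; simp [constStack, CFIterLike.QHalf.params]) (by rw [show (422 : ℕ) = 123 + (296 + 3) by norm_num, q 3]; simp [constStack, CFIterLike.QHalf.params]) (by rw [show (423 : ℕ) = 123 + (296 + 4) by norm_num, q 4]; simp [constStack, CFIterLike.QHalf.params])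
    (by rw [show (424 : ℕ) = 123 + (296 + 5) by norm_num, q 5]; simp [constStack, CFIterLike.QHalf.params]) (by rw [show (425 : ℕ) = 123 + (296 + 6) by norm_num, q 6]; simp [constStack, CFIterLike.QHalf.params]) (by rw [show (426 : ℕ) = 123 + (296 + 7) by norm_num, q 7]; simp [constStack, CFIterLike.QHalf.params]) (by rw [show (427 : ℕ) = 123 + (296 + 8) by norm_num, q 8]; simp [constStack, CFIterLike.QHalf.params]) (by rw [show (428 : ℕ) = 123 + (296 + 9) by norm_num, q 9]; simp [constStack, CFIterLike.QHalf.params])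
  set stk2 := TProg.runF block2 stk1 with hstk2
  have hP2 : ∀ i, getReg (fun _ => (0 : ℝ)) stk2 (120 + i) = getReg (fun _ => (0 : ℝ)) stk1 i := by
    intro i; rw [hstk2, ← block_lengths.2.1]; exact CFIterLike.QHalf.getReg_runF_add _ block2 _ i
  have h3 := block3_regs stk2 Xa Real.pi CFIterLike.QHalf.mA (fun t => CFIterLike.QHalf.Drc coeff Xa (CFIterLike.QHalf.mA t) (Real.pi * t))
    (fun t => Xa + CFIterLike.QHalf.mA t * Real.cos (Real.pi * t)) (fun t => CFIterLike.QHalf.F2c coeff Xa (CFIterLike.QHalf.mA t) (Real.pi * t)) h2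
    (by rw [show (120 : ℕ) = 120 + 0 by norm_num, hP2, hD])
    (by rw [show (237 : ℕ) = 120 + 117 by norm_num, hP2, hX])
    (by rw [show (243 : ℕ) = 120 + 123 by norm_num, hP2, hm])
    (by rw [show (546 : ℕ) = 120 + (123 + (296 + 7)) by norm_num, hP2, q 7]; simp [constStack, CFIterLike.QHalf.params])
    (by rw [show (548 : ℕ) = 120 + (123 + (296 + 9)) by norm_num, hP2, q 9]; simp [constStack, CFIterLike.QHalf.params]) t
  unfold TProg.toFunP
  rw [hrun, h3]

/-! ## §3 Soundness of the per-panel obligation -/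

/-- **SOUNDNESS OF `ShearCert.ok`**: the lane's integral segment of the shear-kernel program holds with the claimed bounds on panel `d.j`. -/
theorem sound_of_ok {d : CFIterLike.QHalfShear.ShearCert} (h : d.ok = true) :
    FSegOK (progQ.toFunP CFIterLike.QHalf.params) [1] CFIterLike.QHalf.tmS (panelLeft CFIterLike.QHalf.hw d.j) (panelLeft CFIterLike.QHalf.hw (d.j + 1)) d.plo d.phi := by
  simp only [ShearCert.ok, Bool.and_eq_true, decide_eq_true_eq] at h
  obtain ⟨⟨hok, hplo⟩, hphi⟩ := h
  unfold panelModels at hok hplo hphi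
  rw [← CFIterLike.QHalf.pc_eq] at hok hplo hphi
  exact fsegOK_of_panelCheckT (CFIterLike.QHalf.panelCheckT_of_parts CFIterLike.QHalf.tmS_pos CFIterLike.QHalf.hw_pos hok hplo hphi) CFIterLike.QHalf.boxMem_params

end Summit.Ventures.FusionMHD.Models.CFIterLike.QHalfShear

end
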